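import Summits.Ventures.GridStability.Models.DroopQVPortHamiltonianStrict
import Summits.Ventures.GridStability.Models.DroopQVGainAffine

/-!
# GridStability/Models/DroopQVPortHamiltonianGains — the solver-free sharp lane is ROBUST IN THE P–f DROOP GAINS: one Hessian certificate serves every positive gain vector

Cell `gridfusion` (LADDER-GRIDFUSION, APEX LINE rung G3.b; seat gridfusion-model-8 (g4); default-work item (E) of the parametric programme after lead g8
RULING 9ax (1)). The sharp family theorem `DroopMicrogrid.re_eig_neg_or_rotation_of_hessQ` (`Models/DroopQVPortHamiltonianStrict.lean`, p525467) needs ONE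
positive definite certificate `𝒬(θ, V) + c·r rᵀ ≻ 0` of the Hessian pattern `𝒬` ([cite: ShinZavala2020, eqs. (10)–(12)]) of the lossless droop+QV
microgrid [cite: KunduEtAl2019, eqs. (4a)–(4c)]. OBSERVATION typed here: the P–f droop gains `k_Pi` enter `𝒬` only through the decoupled frequency
block `diag(τ_Pi/k_Pi)`; replacing the gains by ANY vector `κ` with `k_Pi/κ_i > 0` is a CONGRUENCE by the invertible diagonal matrix
`C = diag(1, √(k_P/κ), 1)` (`hessQ_withKP_eq_conj`), which also fixes `r rᵀ`; hence
* `hessQ_add_rankOne_posDef_withKP`: the instance certificate for the printed gains IS a certificate for every positive gain vector;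
* `hessQ_transpose_withKP`: symmetry of `𝒬` is inherited;
* `re_eig_neg_or_rotation_of_hessQ_withKP` / `no_jordan_chain_at_zero_of_hessQ_withKP`: for EVERY `κ` with all `κ_i > 0` (given printed
  `k_Pi > 0`, `τ_Pi > 0`, `k_Qi V_i/τ_Qi > 0`), every complex eigenpair of `jacMatrix (withKP κ) (θ, V)` has `Re μ < 0` or is the rotation mode,
  and the rotation zero carries no Jordan chain — `n` independent gain parameters, no new certificate, no rate.
Complement of the RATE certificates on gain boxes / rays (`Models/DroopQVGainAffine.lean`, `Models/WSCC9DroopQV*Gain*.lean`): sign-robustness for all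
gains from the port-Hamiltonian structure versus rate-robustness on parameter sets from affine Lyapunov families. THREE COLUMNS. CERTIFIED (kernel):
matrix statements about MODEL N1 (MV-6N); no instance, no numbers; no sentence of this file says a converter or a microgrid is stable.
-/

noncomputable section

open Real Matrix Finset
open scoped ComplexOrder

namespace Summit.Ventures.GridStability.Models

namespace DroopMicrogrid

variable {n : ℕ} (mg : DroopMicrogrid n) (κ : Fin n → ℝ)

/-- The diagonal gain-rescaling `C = diag(1, √(k_Pi/κ_i), 1)` on `(θ, ω, V)`. [folklore] -/
def gainScale : Matrix (Fin n ⊕ (Fin n ⊕ Fin n)) (Fin n ⊕ (Fin n ⊕ Fin n)) ℝ :=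
  Matrix.diagonal (Sum.elim (fun _ => (1 : ℝ)) (Sum.elim (fun i => Real.sqrt (mg.kP i / κ i)) (fun _ => (1 : ℝ))))

/-- The scaling vector. [folklore] -/
def gainScaleVec : Fin n ⊕ (Fin n ⊕ Fin n) → ℝ :=
  Sum.elim (fun _ => (1 : ℝ)) (Sum.elim (fun i => Real.sqrt (mg.kP i / κ i)) (fun _ => (1 : ℝ)))

/-- `C` is the diagonal matrix of the scaling vector. [folklore] -/
theorem gainScale_eq : mg.gainScale κ = Matrix.diagonal (mg.gainScaleVec κ) := rfl

/-- `C` is real symmetric: `Cᴴ = C`. [folklore] -/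
theorem gainScale_conjTranspose : (mg.gainScale κ)ᴴ = mg.gainScale κ := by
  rw [gainScale_eq, Matrix.diagonal_conjTranspose, star_trivial]

variable {κ}

/-- All scaling entries are nonzero when `k_Pi/κ_i > 0`. [folklore] -/
theorem gainScaleVec_ne_zero (hk : ∀ i, 0 < mg.kP i / κ i) (a : Fin n ⊕ (Fin n ⊕ Fin n)) : mg.gainScaleVec κ a ≠ 0 := by
  rcases a with i | i | i
  · simp [gainScaleVec]
  · simp only [gainScaleVec, Sum.elim_inr, Sum.elim_inl]
    exact (Real.sqrt_pos.2 (hk i)).ne'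
  · simp [gainScaleVec]

/-- `C` acts injectively. [folklore] -/
theorem gainScale_mulVec_injective (hk : ∀ i, 0 < mg.kP i / κ i) : Function.Injective (mg.gainScale κ).mulVec := by
  intro x y hxy
  funext a
  have h := congr_fun hxy a
  rw [gainScale_eq, Matrix.mulVec_diagonal, Matrix.mulVec_diagonal] at h
  exact mul_left_cancel₀ (mg.gainScaleVec_ne_zero hk a) h

/-- Entries of a diagonal congruence: `(C M C) a b = c_a · M a b · c_b`. [folklore] -/
theorem diagonal_mul_mul_diagonal_apply (d : Fin n ⊕ (Fin n ⊕ Fin n) → ℝ)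
    (M : Matrix (Fin n ⊕ (Fin n ⊕ Fin n)) (Fin n ⊕ (Fin n ⊕ Fin n)) ℝ) (a b : Fin n ⊕ (Fin n ⊕ Fin n)) :
    (Matrix.diagonal d * M * Matrix.diagonal d) a b = d a * M a b * d b := by
  rw [Matrix.mul_diagonal, Matrix.diagonal_mul]

/-- **The Hessian pattern of `withKP κ` is the congruence `C·𝒬·C`** (`k_Pi/κ_i > 0`): the gains enter `𝒬` only through the decoupled frequency block
`diag(τ_P/k_P)`. [cite: ShinZavala2020, eqs. (10)–(11)] -/
theorem hessQ_withKP_eq_conj (hk : ∀ i, 0 < mg.kP i / κ i) (θ V : Fin n → ℝ) :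
    (mg.withKP κ).hessQ θ V = (mg.gainScale κ)ᴴ * mg.hessQ θ V * mg.gainScale κ := by
  have key : ∀ i, Real.sqrt (mg.kP i / κ i) * (mg.τP i / mg.kP i) * Real.sqrt (mg.kP i / κ i) = mg.τP i / κ i := by
    intro i
    have hs : Real.sqrt (mg.kP i / κ i) * Real.sqrt (mg.kP i / κ i) = mg.kP i / κ i := Real.mul_self_sqrt (hk i).le
    have hkne : mg.kP i ≠ 0 := by
      intro h0; have := hk i; rw [h0, zero_div] at this; exact lt_irrefl _ this
    have hκne : κ i ≠ 0 := by
      intro h0; have := hk i; rw [h0, div_zero] at this; exact lt_irrefl _ this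
    calc Real.sqrt (mg.kP i / κ i) * (mg.τP i / mg.kP i) * Real.sqrt (mg.kP i / κ i)
        = (Real.sqrt (mg.kP i / κ i) * Real.sqrt (mg.kP i / κ i)) * (mg.τP i / mg.kP i) := by ring
      _ = (mg.kP i / κ i) * (mg.τP i / mg.kP i) := by rw [hs]
      _ = mg.τP i / κ i := by field_simp
  rw [gainScale_conjTranspose, gainScale_eq]
  ext a b
  rw [diagonal_mul_mul_diagonal_apply]
  rcases a with i | i | i <;> rcases b with j | j | j
  · simp [DroopMicrogrid.hessQ, block3, gainScaleVec]
  · simp [DroopMicrogrid.hessQ, block3, gainScaleVec]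
  · simp [DroopMicrogrid.hessQ, block3, gainScaleVec]
  · simp [DroopMicrogrid.hessQ, block3, gainScaleVec]
  · simp only [DroopMicrogrid.hessQ, block3, Matrix.fromBlocks_apply₂₂, Matrix.fromBlocks_apply₁₁, gainScaleVec, Sum.elim_inr,
      Sum.elim_inl, Matrix.diagonal_apply, withKP_τP, withKP_kP]
    by_cases h : i = j
    · subst h; simp only [if_true]; exact (key i).symm
    · simp [h]
  · simp [DroopMicrogrid.hessQ, block3, gainScaleVec]
  · simp [DroopMicrogrid.hessQ, block3, gainScaleVec]
  · simp [DroopMicrogrid.hessQ, block3, gainScaleVec]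
  · simp [DroopMicrogrid.hessQ, block3, gainScaleVec]

/-- `C` fixes the rotation rank-one term: `C (c·r rᵀ) C = c·r rᵀ` (`r = [1; 0; 0]` has no frequency part). [folklore] -/
theorem gainScale_conj_vecMulVec_rot (c : ℝ) :
    (mg.gainScale κ)ᴴ * (c • Matrix.vecMulVec rot rot) * mg.gainScale κ = c • Matrix.vecMulVec rot rot := by
  rw [gainScale_conjTranspose, gainScale_eq]
  ext a b
  rw [diagonal_mul_mul_diagonal_apply]
  rcases a with i | i | i <;> rcases b with j | j | j <;> simp [rot, gainScaleVec, Matrix.vecMulVec_apply]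

/-- **One certificate for all gains**: `𝒬 + c·r rᵀ ≻ 0` for `mg` implies the same for `withKP κ`, every `κ` with `k_Pi/κ_i > 0`. CERTIFIED. [folklore] -/
theorem hessQ_add_rankOne_posDef_withKP (hk : ∀ i, 0 < mg.kP i / κ i) (θ V : Fin n → ℝ) {c : ℝ}
    (hP : (mg.hessQ θ V + c • Matrix.vecMulVec rot rot).PosDef) :
    ((mg.withKP κ).hessQ θ V + c • Matrix.vecMulVec rot rot).PosDef := by
  have h := hP.conjTranspose_mul_mul_same (mg.gainScale_mulVec_injective hk)
  rw [Matrix.mul_add, Matrix.add_mul, ← mg.hessQ_withKP_eq_conj hk, gainScale_conj_vecMulVec_rot] at h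
  exact h

/-- **Symmetry is inherited**: `𝒬ᵀ = 𝒬` for `mg` implies the same for `withKP κ` (`k_Pi/κ_i > 0`). [folklore] -/
theorem hessQ_transpose_withKP (hk : ∀ i, 0 < mg.kP i / κ i) (θ V : Fin n → ℝ) (hsymm : (mg.hessQ θ V)ᵀ = mg.hessQ θ V) :
    ((mg.withKP κ).hessQ θ V)ᵀ = (mg.withKP κ).hessQ θ V := by
  rw [mg.hessQ_withKP_eq_conj hk, gainScale_conjTranspose, Matrix.transpose_mul, Matrix.transpose_mul, hsymm, gainScale_eq,
    Matrix.diagonal_transpose, Matrix.mul_assoc]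

/-- **THE SHARP SOLVER-FREE THEOREM, ROBUST IN THE P–f GAINS (any `n`).** Base model with `k_Pi > 0`, `τ_Pi > 0`, `k_Qi ≠ 0`, `k_Qi V_i/τ_Qi > 0`,
`V_i ≠ 0`, a SYMMETRIC Hessian pattern at `(θ, V)` and ONE certificate `𝒬(θ, V) + c·r rᵀ ≻ 0`. Then for EVERY gain vector `κ` with all `κ_i > 0`, every
complex eigenpair `(μ, v)` of `jacMatrix (withKP κ) (θ, V)` has `Re μ < 0`, or `μ = 0` with `v ∈ ℂ·r`. CERTIFIED (matrix statement about MODEL N1,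
MV-6N; `n` free gain parameters, no rate); [cite: ShinZavala2020, Prop. 1] [cite: KunduEtAl2019, eqs. (4a)–(4c)]. No stability sentence. -/
theorem re_eig_neg_or_rotation_of_hessQ_withKP (θ V : Fin n → ℝ) (hkP : ∀ i, 0 < mg.kP i) (hτP : ∀ i, 0 < mg.τP i)
    (hkQ : ∀ i, mg.kQ i ≠ 0) (hV : ∀ i, V i ≠ 0) (hRQ : ∀ i, 0 < mg.kQ i * V i / mg.τQ i)
    (hsymm : (mg.hessQ θ V)ᵀ = mg.hessQ θ V) {c : ℝ} (hP : (mg.hessQ θ V + c • Matrix.vecMulVec rot rot).PosDef)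
    (hκ : ∀ i, 0 < κ i) {μ : ℂ} {v : Fin n ⊕ (Fin n ⊕ Fin n) → ℂ} (hv : v ≠ 0)
    (hJv : ((mg.withKP κ).jacMatrix θ V).map ((↑) : ℝ → ℂ) *ᵥ v = μ • v) :
    μ.re < 0 ∨ (μ = 0 ∧ ∃ a : ℂ, v = fun k => a * ((rot k : ℝ) : ℂ)) := by
  have hk : ∀ i, 0 < mg.kP i / κ i := fun i => div_pos (hkP i) (hκ i)
  exact (mg.withKP κ).re_eig_neg_or_rotation_of_hessQ θ V (fun i => (hκ i).ne') (fun i => (hτP i).ne') hkQ hV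
    (fun i => by rw [withKP_kP, withKP_τP]; exact div_pos (hκ i) (pow_pos (hτP i) 2)) (fun i => by rw [withKP_kQ, withKP_τQ]; exact hRQ i)
    (mg.hessQ_transpose_withKP hk θ V hsymm) (mg.hessQ_add_rankOne_posDef_withKP hk θ V hP) hv hJv

/-- **No Jordan chain at the rotation zero, for every positive gain vector** (structural; needs only the inherited symmetry). [folklore] -/
theorem no_jordan_chain_at_zero_of_hessQ_withKP (θ V : Fin n → ℝ) (hkP : ∀ i, 0 < mg.kP i) (hτP : ∀ i, 0 < mg.τP i)
    (hkQ : ∀ i, mg.kQ i ≠ 0) (hV : ∀ i, V i ≠ 0) (hRQ : ∀ i, 0 < mg.kQ i * V i / mg.τQ i)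
    (hsymm : (mg.hessQ θ V)ᵀ = mg.hessQ θ V) (i₀ : Fin n) (hκ : ∀ i, 0 < κ i) {w : Fin n ⊕ (Fin n ⊕ Fin n) → ℂ}
    (hw : ((mg.withKP κ).jacMatrix θ V).map ((↑) : ℝ → ℂ) *ᵥ w = fun k => ((rot k : ℝ) : ℂ)) : False := by
  have hk : ∀ i, 0 < mg.kP i / κ i := fun i => div_pos (hkP i) (hκ i)
  exact (mg.withKP κ).no_jordan_chain_at_zero_of_hessQ θ V (fun i => (hκ i).ne') (fun i => (hτP i).ne') hkQ hV
    (fun i => by rw [withKP_kP, withKP_τP]; exact div_pos (hκ i) (pow_pos (hτP i) 2)) (fun i => by rw [withKP_kQ, withKP_τQ]; exact hRQ i)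
    (mg.hessQ_transpose_withKP hk θ V hsymm) i₀ hw

end DroopMicrogrid

end Summit.Ventures.GridStability.Models

end
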